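import Literature.NumberTheory.LFunctions.Zhang2022.Section2Assembly

/-!
# Zhang (2022) Part III (§§12–18, §2 endgame, Prop. 14.1): the parameter / constraint layer, typed

Trunk T-ANT (NumberTheory/LFunctions). Y. Zhang, *Discrete mean estimates and the Landau–Siegel
zero*, arXiv:2211.02515v1 (2022) [Zhang2022LandauSiegel] — an unrefereed manuscript under
adjudication (cell pub-zhang: audit + repair census; **no claim about Landau–Siegel**). **Nothing in
this file asserts or denies its Theorems 1–2, its Propositions 2.1–2.6, 14.1, or any of its
analytic lemmas.** It records, as DATA, the design parameters that Part III of the manuscript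
(§§12–18 together with the §2 endgame and Proposition 14.1) manipulates, and, as a `Prop`, the
conjunction `Admissible` of the parameter inequalities those sections actually use (support
arithmetic of the mollifier pieces, the scale orderings, the two shift identities of §12, the
hypothesis `|β| < 5α` of Prop. 14.1, and the printed numerical closing conditions of §2/§18) — the
Lean face of the cell's `constraints/part3.json` (unit b2b-zhang-dep-3, schema pub-zhang/CONSTRAINTS/1,
version part3-v3; row ids quoted in the docstrings; first version keyed to `CONSTRAINTS-III.json` III-v1).
The EXPONENT-CONSUMPTION inequalities — how §§13–17 spend the Part-I outputs `t₀^{-1}`, Lemma 5.1/5.2's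
`𝓛^{-123}`, Lemma 6.1's `E₁` (prefactor `𝓛^{-68}`, `v`-cut `𝓛^{20}`, `ω₁`-mass `𝓛^{15}`), Lemma 4.8's
`𝓛^{-100}`, Prop. 2.1's `#Ψ₂ ≪ 𝔓𝓛^{-739}` and `ε` in the error budgets (13.11), (13.3), (15.4), (17.2),
(17.7) — are the separate predicate `ExponentConsumption` over the record `PartIIIImports` of imported
exponents (cell rows R1–R13, typer III g26 / dep-3 gen 2), conjoined in `AdmissibleR`; they are
SUFFICIENT bookkeeping conditions of one admissible Cauchy–Schwarz/Hölder pairing each (the manuscript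
writes "we can verify" and one example), all slack at the printed design, and — like everything here —
assert nothing analytic. The only theorems are

* `PartIIIDesign.printed_admissible` (and `printed_admissibleR`): the PRINTED design satisfies `Admissible`
  (resp. also `ExponentConsumption` at the printed imports `20, 30, 100, 10, 1.02`) — decidable
  arithmetic on the printed literals (`0.5 + 0.498 < 1`, `4·(3/2) = 1+2+3`, `√(0.001·3000) < 2 < 5`,
  `6.9955 + 6.9955 − 2·6.9951 < 0.001`, `2·4·1100 < 3000π`, …), i.e. the manuscript's parameter
  bookkeeping is internally consistent AS PRINTED;
* `PartIIIDesign.conclusion_of_endgameArithmetic` / `conclusion_of_admissible`: the abstract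
  implication "admissible parameters ⇒ the §2 endgame closes", where *closes* (`ConclusionPartIII`)
  means: ANY endgame datum (`EndgameData`, `Section2Assembly`) satisfying the six inputs that Parts
  II–III CLAIM to deliver at those constants — (8.23)+(8.24), (9.7)+(9.8), (18.1)+(18.2), (2.33),
  Prop. 2.4, Prop. 2.6, with o-terms `η𝔞𝔓`, `ε𝔞𝔓` below explicit thresholds — is contradictory.
  This is `EndgameData.false_of_closing` re-keyed by the design record; it is real arithmetic, not
  analysis.

Whether the six inputs HOLD is exactly what is not claimed: the cell CERTIFIED that (8.24) fails
(`Section8Certificate`: `not_ineq824`, `𝔠₁ = 7.05010…` vs `< 6.9955`), that (18.2) fails by `0.004`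
(`Section18Certificate.not_ineq182`) and that `𝔠₁ + 𝔠₂ + 2Re 𝔠₃ = 0.0553… ≥ 0.001` for the printed
`ι` and `≥ 0.0249` for every `ι` (`not_ineq18sum`, `Section18AllIota`), so `EndgameInputs printed`
is not available with `η` below threshold; see those files. What is deliberately NOT here: any
Dirichlet series, any discrete mean, any `o(·)`; the Part I / Part II constraint layers (cell seats
dep-1 / dep-2); the residual-class analysis of the endgame (`MainTermForm*`).
-/

noncomputable section

open Complex Real ComplexConjugate

namespace Literature.NumberTheory.LFunctions.Zhang2022

/-- The design parameters of the manuscript that Part III (§§12–18), the §2 endgame and Prop. 14.1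
read or constrain. Exponents of `𝓛 = log D` are real fields (`P = exp 𝓛^{kP}`, `t₀ = 𝓛^{k0}`, …);
mollifier lengths are exponents of `P` (`P₁ = P^{th1}`, …); shifts are in units of `iα`, `α = π/log P`
(`β_j = i·b_j·α(1+O(α𝓛))`). Field ↔ display: `A0` (A); `kP` (2.6); `w` (`p ∼ P`); `k1,k0` (2.8);
`k2` (2.15); `xPsi2` Prop. 2.1; `kT` §6 (`T = exp 𝓛^{kT}`); `gT2` the `T^{-10}` in `P₂` (2.21);
`b1,b2,b3` (2.13); `b6,b7` (2.22); `th1,th2,th3` (2.21); `th14` (12.1); `z0,z1,z2,slope` the tent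
`f̃` (2.28); `dJ` (2.30); `d24` Prop. 2.4; `c25` Prop. 2.5; `q232` (2.32); `cJ` (2.33); `B824` (8.24);
`B98` (9.8); `B182` (18.2); `W1,W2,W3` the residue weights `1/(2α), 2/α, 3/(2α)` of (12.14)/(18.3)ff;
`main18`, `crude` the `1000𝔞/log P`, `1100𝔞/log P` of the proof of (2.33); `kPI` the number of
partial integrations in the `1 < r < D³` branch of (14.8) (cell row III-14.8).
[cite: Zhang2022LandauSiegel, §2 (2.6)–(2.33), §12 (12.1), §14, §18] -/
structure PartIIIDesign where
  /-- (A): `L(1,χ) < 𝓛^{-A0}` -/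
  A0 : ℕ
  /-- (2.6): `P = exp(𝓛^{kP})` -/
  kP : ℝ
  /-- `p ∼ P ⇔ P < p < P(1 + 𝓛^{-w})` -/
  w : ℝ
  /-- (2.8): `𝓛₁ = 𝓛^{k1}` -/
  k1 : ℝ
  /-- (2.8): `t₀ = 𝓛^{k0}` -/
  k0 : ℝ
  /-- (2.15): `𝓛₂ = 𝓛^{k2}` -/
  k2 : ℝ
  /-- §6: `T = exp(𝓛^{kT})` -/
  kT : ℝ
  /-- Prop. 2.1: `#Ψ₂ ≪ 𝔓𝓛^{-xPsi2}` -/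
  xPsi2 : ℝ
  /-- (2.21): `P₂ = P^{th2}T^{-gT2}` -/
  gT2 : ℝ
  /-- (2.13): `β₁ = i·b1·α(1−5c′α𝓛)` -/
  b1 : ℝ
  /-- (2.13): `β₂ = i·b2·α(1+c′α𝓛)` -/
  b2 : ℝ
  /-- (2.13): `β₃ = i·b3·α(1−c′α𝓛)` -/
  b3 : ℝ
  /-- (2.22): `β₆ = i·b6·α` -/
  b6 : ℝ
  /-- (2.22): `β₇ = i·b7·α` -/
  b7 : ℝ
  /-- (2.21): `P₁ = P^{th1}` -/
  th1 : ℝ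
  /-- (2.21): `P₂ = P^{th2}T^{-gT2}` -/
  th2 : ℝ
  /-- (2.21): `P₃ = P^{th3}` -/
  th3 : ℝ
  /-- (12.1): `H₁₁ = H₁₄ (n < P^{th14}) + H₁₅` -/
  th14 : ℝ
  /-- (2.28): `f̃ = 0` below `z0` -/
  z0 : ℝ
  /-- (2.28): apex of the tent -/
  z1 : ℝ
  /-- (2.28): `f̃ = 0` above `z2` -/
  z2 : ℝ
  /-- (2.28): slope of the tent -/
  slope : ℝ
  /-- (2.30): shift in `J₂` -/
  dJ : ℝ
  /-- Prop. 2.4: `|Ξ₁*| > d24·𝔞𝔓` -/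
  d24 : ℝ
  /-- Prop. 2.5: `Ξ₂* < c25·𝔞𝔓` -/
  c25 : ℝ
  /-- (2.32): `Ξ₁ < q232·𝔞𝔓` -/
  q232 : ℝ
  /-- (2.33): `Ξ_J < cJ·𝔞𝔓` -/
  cJ : ℝ
  /-- (8.24): `𝔠₁ < B824` -/
  B824 : ℝ
  /-- (9.8): `𝔠₂ < B98` -/
  B98 : ℝ
  /-- (18.2): `Re 𝔠₃ < B182` -/
  B182 : ℝ
  /-- weight of `S₁`: `(1/(2α))S₁` -/
  W1 : ℝ
  /-- weight of `S₂`: `(2/α)S₂` -/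
  W2 : ℝ
  /-- weight of `S₃`: `(3/(2α))S₃` -/
  W3 : ℝ
  /-- §18: main contribution `main18·𝔞/log P` to `S_j(a₂₃,a₂₃)` -/
  main18 : ℝ
  /-- §18: crude bound `Re S_j(a₂₃,a₂₃) < crude·𝔞/log P` -/
  crude : ℝ
  /-- (14.8): number of partial integrations in the branch `1 < r < D³` -/
  kPI : ℕ

/-- **Part-I exponents that Part III CONSUMES in its error budgets** (they are outputs / internal
constants of §§4–6, owned by the Part-I layer; recorded here only so that the consumption rows can be
stated over them; cell params `ev`, `eom1`, `e410`, `eeps`, `e102`). `ev`: the cut `|v| < 𝓛^{ev}` in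
`E₁(s,ψ) = 𝓛^{-68}∫_{|v|<𝓛^{20}}|Σ_{n<T³}ψ(n)n^{-s-iv}|ω₁(iv)dv + ε` (Lemma 6.1); `eom1`:
`ω₁(w) = exp{w²/(4𝓛^{30})}`, so `∫ω₁(iv)dv ≍ 𝓛^{eom1/2}`; `e410`: Lemma 4.8
`z̃(ρ)^{-1} = −G(ρ)F(1−ρ,ψ̄) + O(𝓛^{-100})`; `eeps`: `ε = exp(−c𝓛^{10})`; `e102`: the exponent `1.02`
of Lemma 5.3's `Δ`-bound used at (14.4) / App. A. The `E₁`/(5.2) prefactor exponent is NOT a separate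
datum: it equals `min(w, k0 − k1)` (`pt/2π = Pt₀(1 + O(𝓛^{-68}))` for `p ∼ P`; cell row III-L6.1w).
[cite: Zhang2022LandauSiegel, §4 (ω₁, ε, Lemma 4.8), Lemma 5.1, Lemma 5.3, Lemma 6.1] -/
structure PartIIIImports where
  /-- `|v| < 𝓛^{ev}` (Lemma 4.4 proof, Lemma 5.1, Lemma 6.1) -/
  ev : ℝ
  /-- `ω₁(w) = exp{w²/(4𝓛^{eom1})}` -/
  eom1 : ℝ
  /-- Lemma 4.8: `O(𝓛^{-e410})` -/
  e410 : ℝ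
  /-- `ε = exp(−c𝓛^{eeps})` -/
  eeps : ℝ
  /-- Lemma 5.3: `Δ(x) ≪ … 𝓛^{e102·(…)}`, printed `1.02` (`3·1.02 = 3.06` at (14.4) / App. A) -/
  e102 : ℝ

namespace PartIIIImports

/-- The imported exponents AS PRINTED: `|v| < 𝓛^{20}`, `ω₁` with `𝓛^{30}`, Lemma 4.8's `𝓛^{-100}`,
`ε = exp(−c𝓛^{10})`, Lemma 5.3's `1.02`. [cite: Zhang2022LandauSiegel, §4, §5] -/
def printed : PartIIIImports where
  ev := 20
  eom1 := 30
  e410 := 100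
  eeps := 10
  e102 := 1.02

end PartIIIImports

namespace PartIIIDesign

/-- The design AS PRINTED in arXiv:2211.02515v1: `(A)` with `2022`; (2.6) `9`; window `68`; (2.8)
`405, 519`; (2.15) `400`; §6 `1.1`; Prop. 2.1 `739`; (2.21) `0.504, 0.5 (T^{-10}), 0.498`; (2.13)
`1,2,3`; (2.22) `3/2, 5/2`; (12.1) `1/2`; (2.28) `0.5, 0.502, 0.504, 500`; (2.30) `0.004`; Props.
2.4/2.5 `5, 2`; (2.32)/(2.33) `0.001, 3000`; (8.24)/(9.8)/(18.2) `6.9955, 6.9955, −6.9951`; weights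
`1/2, 2, 3/2`; §18 `1000, 1100`; (14.8) two partial integrations ("Lemma 5.4 (i)").
[cite: Zhang2022LandauSiegel, §2, §6, §12 (12.1), §14, §18] -/
def printed : PartIIIDesign where
  A0 := 2022
  kP := 9
  w := 68
  k1 := 405
  k0 := 519
  k2 := 400
  kT := 1.1
  xPsi2 := 739
  gT2 := 10
  b1 := 1
  b2 := 2
  b3 := 3
  b6 := 3 / 2
  b7 := 5 / 2
  th1 := 0.504
  th2 := 0.5
  th3 := 0.498
  th14 := 0.5
  z0 := 0.5
  z1 := 0.502
  z2 := 0.504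
  slope := 500
  dJ := 0.004
  d24 := 5
  c25 := 2
  q232 := 0.001
  cJ := 3000
  B824 := 6.9955
  B98 := 6.9955
  B182 := -6.9951
  W1 := 1 / 2
  W2 := 2
  W3 := 3 / 2
  main18 := 1000
  crude := 1100
  kPI := 2

/-- **Support and exponent arithmetic used in §§12–18** (cell rows in brackets).
`th14 + th3 < 1`: the products `H₁₄H₁₃` fit under `PT^{-2}η₊` — (15.2) `b(n) = 0 for n > PT^{-2}η₊`,
§16 "the length of `B(s,ψ)N(s+β₃,ψ)` is `≤ PT^{-1}`" [III-12.len, III-15.2, III-16.len];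
`th14 + th2 ≤ 1` with the `T^{-gT2}`, `gT2 ≥ 5`, room of `P₂` [III-12.len]; `th14 < th1 < 1`,
`th2, th3 < 1`: `H₁₅ ≠ 0` and the supports fed to Lemma 8.1 at (12.9), (18.3) lie below `PT^{-2}`
((7.2)) [III-12.1, III-12.9, III-18.3, X-7.2]; the tent of (2.28) is a symmetric hat of height `1`
glued to `H₁₅`: `z0 = th14`, `z2 = th1`, `slope·(z1 − z0) = slope·(z2 − z1) = 1`, and the `J₂` shift
is `dJ = z2 − z0` [III-2.28, III-2.30, III-12.Ppp]; `1 < kT < kP`: `T = exp 𝓛^{kT}` exceeds every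
power of `D` (Lemma 5.6's `r < T`, the `D⁴`-smooth parts `n₁ < T`, "`Dpk/l₂ > T`") and is `P^{o(1)}`
(`P₄^{β₃−β_j} = e^{(b3−bj)πi}(1+o(1))`) [III-14.8, III-15.q, III-15.r1]; `k2 < k1 < k0`: `ω` decays
inside `Ω` and `Ω` sits at height `t₀` [III-2.15, III-2.8]; `(2·25 + 4)·kP + 3(w + kP) < xPsi2`
(`= 717 < 739`): the Hölder step behind the `Ψ₁ → Ψ` extensions (14.3), (15.4), §§16–17 costs
`o(𝔓)` — the divisor moments `Σ τ₅²/m ≍ (log P)^{25}`, `Σ τ₂²/n ≍ (log P)^{4}` are powers of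
`log P = 𝓛^{kP}`, not of `𝓛` [III-14.03a; the first version's `54 + 3(w + kP)` (the "285-reading")
under-counted them — corrected per the sweep seats' cross-check, constraints/part3.json]; `0 < b1 < b2 < b3 < 5`: distinct
shifts (simple poles in (15.16), (16.11)) inside Prop. 14.1's `|β| < 5α` [III-2.13, III-14.P].
[cite: Zhang2022LandauSiegel, (2.21), (2.28), (2.30), (12.1), (14.2), (15.2), §16, Prop. 14.1] -/
def SupportAdmissible (p : PartIIIDesign) : Prop :=
  p.th14 + p.th3 < 1 ∧ p.th14 + p.th2 ≤ 1 ∧ 5 ≤ p.gT2 ∧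
  p.th14 < p.th1 ∧ p.th1 < 1 ∧ p.th2 < 1 ∧ p.th3 < 1 ∧
  p.z0 = p.th14 ∧ p.z2 = p.th1 ∧ p.z0 < p.z1 ∧ p.z1 < p.z2 ∧
  p.slope * (p.z1 - p.z0) = 1 ∧ p.slope * (p.z2 - p.z1) = 1 ∧ p.dJ = p.z2 - p.z0 ∧
  1 < p.kT ∧ p.kT < p.kP ∧ p.k2 < p.k1 ∧ p.k1 < p.k0 ∧
  (2 * 25 + 4) * p.kP + 3 * (p.w + p.kP) < p.xPsi2 ∧
  0 < p.b1 ∧ p.b1 < p.b2 ∧ p.b2 < p.b3 ∧ p.b3 < 5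

/-- **The shift design of §12 and the phases of §§15–17** [III-12.id1, III-12.id2, III-16.17,
III-17.9, III-15.r1]: "since `4β₆ − β₁ − β₂ − β₃ ≃ 0`" and "`(2β₆ + 2β₇ − β₁ − β₂ − β₃)log P ≃ 2πi`"
((12.13)→(12.14)); `(pt₀)^{β₁} = −1 + O(α₁)`, `(pt₀)^{β₂} = 1 + O(α₁)`, `(pt₀)^{β₃} = −1 + O(α₁)`
require `b1, b3` odd and `b2` even integers. [cite: Zhang2022LandauSiegel, §12 (12.13)–(12.14), §16 (16.17), §17] -/
def ShiftDesign (p : PartIIIDesign) : Prop :=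
  4 * p.b6 = p.b1 + p.b2 + p.b3 ∧ 2 * (p.b6 + p.b7) - (p.b1 + p.b2 + p.b3) = 2 ∧
  ∃ n₁ n₂ n₃ : ℤ, p.b1 = n₁ ∧ p.b2 = n₂ ∧ p.b3 = n₃ ∧ Odd n₁ ∧ Even n₂ ∧ Odd n₃

/-- **The printed numerical closing conditions of §2/§18** [III-P2.5, III-asm, III-18.sum,
III-18.main, III-18.crude, III-18.4400, III-18.2801]: Prop. 2.5 from (2.32)·(2.33) by
Cauchy–Schwarz, `√(q232·cJ) < c25`; the assembly `c25 < d24` (room for Prop. 2.6's `o(𝔞𝔓)`);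
"It follows from (8.24), (9.8) and (18.2) that `𝔠₁ + 𝔠₂ + 2Re𝔠₃ < 0.001`": `B824 + B98 + 2B182 <
q232`; the proof of (2.33): main contribution `slope²(z2 − z0) = main18` (`500²·0.004 = 1000`),
crude per-`j` bound `main18 < crude`, and `2·(W1+W2+W3)·crude/π < cJ` (`8800/π < 3000`).
[cite: Zhang2022LandauSiegel, §2 (proof of Thm 1), Prop. 2.5, §18] -/
def EndgameArithmetic (p : PartIIIDesign) : Prop :=
  0 ≤ p.q232 ∧ 0 ≤ p.cJ ∧ Real.sqrt (p.q232 * p.cJ) < p.c25 ∧ p.c25 < p.d24 ∧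
  p.B824 + p.B98 + 2 * p.B182 < p.q232 ∧
  p.slope ^ 2 * (p.z2 - p.z0) = p.main18 ∧ p.main18 < p.crude ∧
  2 * (p.W1 + p.W2 + p.W3) * p.crude < p.cJ * Real.pi

/-- `Admissible p`: the conjunction of the Part III DESIGN-level parameter constraints — supports and
scale orderings, the §12 shift design, the §2/§18 closing arithmetic (cell file `constraints/part3.json`,
first keyed to CONSTRAINTS-III.json III-v1). The exponent-consumption rows R1–R13 (how Part III spends
the Part-I exponents) are NOT conjuncts here: they form `ExponentConsumption` below and `AdmissibleR`
is the conjunction of both (added part3-v3; the meaning of `Admissible` is unchanged).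
[cite: Zhang2022LandauSiegel, §§2, 12–18] -/
def Admissible (p : PartIIIDesign) : Prop := p.SupportAdmissible ∧ p.ShiftDesign ∧ p.EndgameArithmetic

/-- The error-term repair of (14.8) recorded by the cell (row III-14.8, referee item 113): the branch
`1 < r < D³` needs `k ≥ 6` partial integrations of the Mellin kernel (net `D`-exponent `5.5 − k`);
the printed text integrates twice. Kept OUT of `Admissible` (it is internal to a proof, not a design
constraint) and recorded separately. [cite: Zhang2022LandauSiegel, §14 (14.8)] -/
def ErrorTermRepair148 (p : PartIIIDesign) : Prop := 6 ≤ p.kPI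

/-- **How Part III spends the Part-I exponents** (cell rows R1–R13 of `constraints/part3.json` part3-v3 /
typer III g26 `PARTIII-ROWS-AUDIT-G26.md` §B; derivations `b2b-zhang-dep-3/R-ROWS-DERIVATION.md`). Each
conjunct says that one error term is `o(𝔓)` under ONE admissible pairing (weight `|L(ρ+β₁,ψ)/L′(ρ,ψ)|ω(ρ)
≥ 0` converted to `𝔍(±α)`-integrals by (2.34), Lemma 5.9's `log P = 𝓛^{kP}` once, Lemma 3.3 (i)/(ii)
with support-aware multiplicative divisor majorants); with `ePfrak = w + kP` (`𝔓 = P²𝓛^{-ePfrak}`, (2.9))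
and `e123 = (k0 − k1) + kP`, `e52 = min(w, k0 − k1)`:
R1 (13.11)(a), the `t₀^{-1}` term: `5.5·kP + w/2 < k0` [III-13.11b]; R2 (13.11)(b),(d), the `𝓛^{-123}`
terms: `2.5·kP + 3·kT < k0 − k1` [III-13.11c]; R3 (13.11)(c), the `E₁(ρ+β₃)` term:
`min(ev, eom1/2) + 3.5·kP + 3·kT < e52` [III-13.11ar1 — supersedes the literal-threshold row `50 < 68`;
the alternative bookkeeping `ev + 3.5·kP + 1.5·kT < e52` (sweep-2 L09b) certifies the same term]; R4
(13.11)(e): `min(ev, eom1/2) + 3·kP + 3.5·kT < e52` [III-13.11d]; R5 (13.3), Lemma 4.8's term: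
`3·kP + 3·kT < e410` [III-13.03b]; R6 (14.3)/(16.1) is the conjunct `(2·25+4)·kP + 3(w+kP) < xPsi2` of
`SupportAdmissible`; R7 (15.4), `Ψ₁ → Ψ` on the lower contour (order β: extend after the termwise
Gaussian integration): `ePfrak + 48·kP < xPsi2` [III-15.04b; text order α: `3·ePfrak + 48·kP`]; R8 (15.4),
the `O(𝓛^{-123})` term: `5.5·kP + w/2 < k0 − k1` [III-15.04c]; R10 (17.2), `Ψ₁ → Ψ` for `Φ₃⁺` with the
SUPPORT-AWARE count of the six-fold `ν*` (`F̂(p) = 8/6/4/2`): `2·ePfrak + 32·kP + 40·kT + 72 < xPsi2`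
[III-17.02a; the naive pointwise `τ₈` count would demand `1322 < 739`, see
`printed_naive_tau8_count_fails`]; R11 (17.7): `ePfrak + 2(4·kP + 12·kT + 20) + 16·kP + 48 < xPsi2`
[III-17.07a]; R12, `ε` against `P^{O(1)}` and the two Gaussian tails: `kP < eeps ≤ 2(k1 − k2)`,
`eeps ≤ 2·ev − eom1` [III-G.epsIII = dep-1 G-eps.a/b/d]; R13 (14.4)/App. A, Lemma 5.3's `Δ`-bound:
`3·e102·k0 − 4·k2 < −kP` [III-14.04a]. All hold at the printed design with the margins `435.5, 88.2,
18.2, 22.15, 69.7, (22), 230, 30.5, 181, 331.6, 1/0/0, 2.86` (raw `lhs − rhs`); none is binding before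
R6. Sufficient, pairing-dependent conditions — NOT necessary conditions of the method, and no analytic
content. [cite: Zhang2022LandauSiegel, §13 (13.3), (13.11), §15 (15.4), §17 (17.2), (17.7), App. A] -/
def ExponentConsumption (p : PartIIIDesign) (q : PartIIIImports) : Prop :=
  11 * p.kP / 2 + p.w / 2 < p.k0 ∧
  5 * p.kP / 2 + 3 * p.kT < p.k0 - p.k1 ∧
  min q.ev (q.eom1 / 2) + 7 * p.kP / 2 + 3 * p.kT < min p.w (p.k0 - p.k1) ∧
  min q.ev (q.eom1 / 2) + 3 * p.kP + 7 * p.kT / 2 < min p.w (p.k0 - p.k1) ∧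
  3 * p.kP + 3 * p.kT < q.e410 ∧
  (p.w + p.kP) + 48 * p.kP < p.xPsi2 ∧
  11 * p.kP / 2 + p.w / 2 < p.k0 - p.k1 ∧
  2 * (p.w + p.kP) + 32 * p.kP + 40 * p.kT + 72 < p.xPsi2 ∧
  (p.w + p.kP) + 2 * (4 * p.kP + 12 * p.kT + 20) + 16 * p.kP + 48 < p.xPsi2 ∧
  p.kP < q.eeps ∧ q.eeps ≤ 2 * (p.k1 - p.k2) ∧ q.eeps ≤ 2 * q.ev - q.eom1 ∧
  3 * q.e102 * p.k0 - 4 * p.k2 < -p.kP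

/-- `AdmissibleR p q`: the design-level constraints AND the exponent-consumption rows (the full Part III
row set of `constraints/part3.json` part3-v3 at the design/exponent layer). [cite: Zhang2022LandauSiegel, §§2, 12–18] -/
def AdmissibleR (p : PartIIIDesign) (q : PartIIIImports) : Prop := p.Admissible ∧ p.ExponentConsumption q

/-- The six inputs that Parts II–III CLAIM to hand to the §2 endgame at the constants of `p`, for an
endgame datum `E` with normaliser `aP = 𝔞𝔓 > 0`, main-term slack `η` and Prop. 2.6 tolerance `ε`:
(8.23)+(8.24) `Ξ₁₁ ≤ (B824 + η)𝔞𝔓`; (9.7)+(9.8) `Ξ₁₂ ≤ (B98 + η)𝔞𝔓`; (18.1)+(18.2)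
`Re Ξ₁₃ ≤ (B182 + η)𝔞𝔓`; (2.33) `Ξ_J ≤ cJ·𝔞𝔓`; Prop. 2.4 `d24·𝔞𝔓 ≤ |Ξ₁*|`; Prop. 2.6 `Ξ₃* ≤ ε𝔞𝔓`.
A `Prop`-valued record: NOT asserted for any `p` (for `printed` the first and third are refuted at
`η` below threshold by `Section8Certificate` / `Section18Certificate`).
[cite: Zhang2022LandauSiegel, (8.23)–(8.24), (9.7)–(9.8), (18.1)–(18.2), (2.33), Props. 2.4, 2.6] -/
structure EndgameInputs (p : PartIIIDesign) {ι : Type*} [Fintype ι] (E : EndgameData ι) (aP η ε : ℝ) : Prop where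
  /-- (8.23) with (8.24) -/
  h823 : E.xi11 ≤ (p.B824 + η) * aP
  /-- (9.7) with (9.8) -/
  h97 : E.xi12 ≤ (p.B98 + η) * aP
  /-- (18.1) with (18.2) -/
  h181 : E.xi13.re ≤ (p.B182 + η) * aP
  /-- (2.33) -/
  h233 : E.xiJ ≤ p.cJ * aP
  /-- Prop. 2.4 -/
  h24 : p.d24 * aP ≤ ‖E.xiStar1‖
  /-- Prop. 2.6 -/
  h26 : E.xiStar3 ≤ ε * aP

/-- **Conclusion of Part III at design `p`** ("This proves Theorem 1", §2 p. 6, as an abstract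
closing property): there are thresholds `η₀, ε₀ > 0` such that NO endgame datum satisfies the six
inputs with `0 < 𝔞𝔓`, `η ≤ η₀`, `ε ≤ ε₀`. [cite: Zhang2022LandauSiegel, §2 (2.18) and proof of Thm 1] -/
def ConclusionPartIII (p : PartIIIDesign) : Prop :=
  ∃ η₀ : ℝ, 0 < η₀ ∧ ∃ ε₀ : ℝ, 0 < ε₀ ∧
    ∀ (ι : Type) [Fintype ι] (E : EndgameData ι) (aP η ε : ℝ),
      0 < aP → η ≤ η₀ → ε ≤ ε₀ → p.EndgameInputs E aP η ε → False

/-- The endgame arithmetic alone closes the §2 skeleton: with `η₀ = (q232 − (B824+B98+2B182))/4` and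
`ε₀ = (d24 − √(q232·cJ))/2`, (8.2) `Ξ₁ = Ξ₁₁ + Ξ₁₂ + 2Re Ξ₁₃ ≤ q232·𝔞𝔓` and
`EndgameData.false_of_closing` apply. Pure real arithmetic. [folklore] -/
theorem conclusion_of_endgameArithmetic (p : PartIIIDesign) (h : p.EndgameArithmetic) : p.ConclusionPartIII := by
  obtain ⟨_, _, hsqrt, hcd, hsum, _, _, _⟩ := h
  refine ⟨(p.q232 - (p.B824 + p.B98 + 2 * p.B182)) / 4, by linarith,
    (p.d24 - Real.sqrt (p.q232 * p.cJ)) / 2, by linarith, ?_⟩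
  intro ι _ E aP η ε haP hη hε hin
  have hgap : 0 ≤ p.q232 - (p.B824 + p.B98 + 2 * p.B182 + 4 * η) := by linarith
  have h232 : E.xi1 ≤ p.q232 * aP := by
    rw [E.xi1_eq]
    nlinarith [mul_nonneg hgap haP.le, hin.h823, hin.h97, hin.h181]
  exact E.false_of_closing haP (by linarith) hin.h24 h232 hin.h233 hin.h26

/-- **"admissible parameters ⇒ the conclusion of Part III"** (the cell brief's
`admissible(params) → conclusion_of_part_3`, stated for every design `p` and proved: only the
endgame-arithmetic conjunct is used; the support/shift conjuncts are hypotheses of the ANALYTIC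
steps of §§12–17, which are not formalised and not claimed). [folklore] -/
theorem conclusion_of_admissible (p : PartIIIDesign) (h : p.Admissible) : p.ConclusionPartIII :=
  p.conclusion_of_endgameArithmetic h.2.2

/-- The printed design satisfies the support/exponent constraints. [cite: Zhang2022LandauSiegel, §§2, 12–16] -/
theorem printed_supportAdmissible : printed.SupportAdmissible := by
  refine ⟨?_, ?_, ?_, ?_, ?_, ?_, ?_, ?_, ?_, ?_, ?_, ?_, ?_, ?_, ?_, ?_, ?_, ?_, ?_, ?_, ?_, ?_, ?_⟩ <;>
    norm_num [printed]

/-- The printed shifts satisfy the two §12 identities and the parities. [cite: Zhang2022LandauSiegel, (2.13), (2.22), (12.13)–(12.14)] -/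
theorem printed_shiftDesign : printed.ShiftDesign := by
  refine ⟨by norm_num [printed], by norm_num [printed], 1, 2, 3, by norm_num [printed],
    by norm_num [printed], by norm_num [printed], ⟨0, by norm_num⟩, ⟨1, by norm_num⟩, ⟨1, by norm_num⟩⟩

/-- The printed closing constants are consistent: `√(0.001·3000) = √3 < 2 < 5`,
`6.9955 + 6.9955 − 2·6.9951 = 0.0008 < 0.001`, `500²·0.004 = 1000 < 1100`, `2·4·1100 = 8800 < 3000π`.
[cite: Zhang2022LandauSiegel, §2 (proof of Thm 1), §18] -/
theorem printed_endgameArithmetic : printed.EndgameArithmetic := by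
  refine ⟨by norm_num [printed], by norm_num [printed], ?_, by norm_num [printed],
    by norm_num [printed], by norm_num [printed], by norm_num [printed], ?_⟩
  · rw [show printed.q232 * printed.cJ = (3 : ℝ) by norm_num [printed],
      show printed.c25 = (2 : ℝ) by norm_num [printed],
      Real.sqrt_lt' (by norm_num)]
    norm_num
  · have hπ := Real.pi_gt_three
    simp only [printed]
    nlinarith

/-- **The manuscript's Part III parameter bookkeeping is internally consistent as printed.**
(Consistency of the constraints, not truth of the inputs.) [cite: Zhang2022LandauSiegel, §§2, 12–18] -/
theorem printed_admissible : printed.Admissible :=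
  ⟨printed_supportAdmissible, printed_shiftDesign, printed_endgameArithmetic⟩

/-- `AdmissibleR` also suffices for the abstract conclusion (only the endgame arithmetic is used; the
exponent rows, like the support rows, are hypotheses of the ANALYTIC inputs, which are not formalised).
[cite: Zhang2022LandauSiegel, §2 (proof of Theorem 1)] -/
theorem conclusion_of_admissibleR (p : PartIIIDesign) (q : PartIIIImports) (h : p.AdmissibleR q) :
    p.ConclusionPartIII :=
  p.conclusion_of_admissible h.1

/-- The printed design spends the printed Part-I exponents consistently: `83.5 < 519`, `25.8 < 114`,
`min(20,15) + 31.5 + 3.3 = 49.8 < 68 = min(68, 114)`, `45.85 < 68`, `30.3 < 100`, `509 < 739`,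
`83.5 < 114`, `558 < 739`, `407.4 < 739`, `9 < 10 ≤ 10`, `10 ≤ 10`, `1588.14 − 1600 < −9`.
[cite: Zhang2022LandauSiegel, §13 (13.11), §15 (15.4), §17 (17.2), (17.7), App. A] -/
theorem printed_exponentConsumption : printed.ExponentConsumption PartIIIImports.printed := by
  refine ⟨?_, ?_, ?_, ?_, ?_, ?_, ?_, ?_, ?_, ?_, ?_, ?_, ?_⟩ <;>
    norm_num [printed, PartIIIImports.printed, min_def]

/-- Hence the printed design satisfies the full row set `AdmissibleR`. [cite: Zhang2022LandauSiegel, §§2, 12–18] -/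
theorem printed_admissibleR : printed.AdmissibleR PartIIIImports.printed :=
  ⟨printed_admissible, printed_exponentConsumption⟩

/-- Record of the bookkeeping WARNING at (17.2) (cell erratum E-III-g26-2, typer III; not in the text):
with the naive POINTWISE majorant `ν* ≪ τ₈` the mean-square exponent would be `64·kP` and the
`Ψ₁ → Ψ` requirement would read `2·ePfrak + 2·64·kP + 16 < xPsi2`, i.e. `1322 < 739` — false at the
printed design; the support-aware count (R10, `558 < 739`) is the one that applies. [folklore] -/
theorem printed_naive_tau8_count_fails :
    ¬ (2 * (printed.w + printed.kP) + 2 * 64 * printed.kP + 16 < printed.xPsi2) := by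
  norm_num [printed]

/-- The superseded literal-threshold reading of (13.11)(c) (cell row III-13.11a: `50 < e52`) is what R3
evaluates to at the printed imports and scales: `min(20, 15) + 3.5·9 + 3·1.1 = 49.8`. [folklore] -/
theorem printed_R3_threshold :
    min PartIIIImports.printed.ev (PartIIIImports.printed.eom1 / 2) + 7 * printed.kP / 2 + 3 * printed.kT
      = 49.8 := by
  norm_num [printed, PartIIIImports.printed, min_def]

/-- … whereas the (14.8) error-term count as printed (two partial integrations) is NOT the repaired
one (`k ≥ 6`, cell row III-14.8). [cite: Zhang2022LandauSiegel, §14 (14.8)] -/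
theorem printed_not_errorTermRepair148 : ¬ printed.ErrorTermRepair148 := by
  simp [ErrorTermRepair148, printed]

/-- The repaired count `kPI = 6` satisfies it (all other fields as printed). [folklore] -/
theorem repaired_errorTermRepair148 : ({ printed with kPI := 6 } : PartIIIDesign).ErrorTermRepair148 := by
  simp [ErrorTermRepair148]

end PartIIIDesign

end Literature.NumberTheory.LFunctions.Zhang2022
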